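import Literature.Computability.MetaComplexity.ResolutionInterpolation
import Literature.Computability.MetaComplexity.CliqueColouringFormulas
import Literature.Computability.Complexity.CliqueSqrtLowerBound
import HarnessLib

/-!
# Exponential resolution lower bound for the clique–colouring formulas via monotone interpolation

The first application of the interpolation method (Krajíček 1997, §7; Pudlák 1997, Thm. 2 for
cutting planes, the resolution case being its warm-up): every resolution refutation of the
clique–colouring CNF `Clique_{m,k}(x,q) ∧ Colour_{m,k-1}(x,r)` with `k = ⌊√m⌋` has length at
least `2^{m^{1/8}} / 2` for all large `m` (`cliqueColour_resolution_lowerBound`).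

Proof: by `resolution_monotone_interpolation'` (`ResolutionInterpolation.lean`) a refutation
`π` yields a monotone circuit over `{∧₂, ∨₂}` with at most `2 |π|` gates computing an
interpolant `I` of the edge variables which accepts every graph whose clique part is
satisfiable — in particular the clique vector of every `k`-set
(`CliqueColouring.cliqueCNF_satOver_cliqueVec`) — and rejects every graph whose colouring part
is satisfiable — in particular the complete multipartite graph of every `(k-1)`-colouring
(`CliqueColouring.colourCNF_satOver_colorVec`); the tree's PROVED Razborov–Alon–Boppana bound
`cliqueSqrt_monotone_lowerBound` (`CliqueSqrtLowerBound.lean`, exponent `m^{1/8}`) gives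
`2^{m^{1/8}} ≤ 2 |π|`.  Together with `CliqueColouring.cliqueColourCNF_not_satisfiable` and the
clause count `≤ 5 m³` this is an explicit sequence of polynomial-size unsatisfiable CNFs with
only exponential-size resolution refutations (`cliqueColour_hard_for_resolution`), a proof of
"resolution is not polynomially bounded" independent of Haken's pigeonhole bound.

## References

* J. Krajíček, J. Symbolic Logic 62 (1997), Thm. 6.1 and §7 [Krajicek1997].
* P. Pudlák, J. Symbolic Logic 62 (1997), Thm. 1, Thm. 2 [Pudlak1997].
* N. Alon, R. Boppana, Combinatorica 7 (1987), Thm. 3.9 / Lemma 3.14 [AlonBoppana1987];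
  S. Jukna, *Boolean Function Complexity* (2012), Thm. 9.26 [Jukna2012].
-/

namespace Literature.Computability.MetaComplexity

open Finset Filter Literature.Computability.Complexity CliqueColouring ResInterpolant

/-- The clique part has only positive edge literals and `q`-literals, i.e. all its literals
count on the `A`-side. [cite: Pudlak1997, §3] -/
theorem cntA_of_mem_cliqueCNF {m k c : ℕ} :
    ∀ C ∈ cliqueCNF m k c, ∀ l ∈ C, cntA l = true := by
  intro C hC l hl
  rcases literal_cliqueCNF hC hl with ⟨e, rfl⟩ | ⟨i, v, b, rfl⟩
  · rfl
  · rfl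

/-- The colouring part has only edge literals and `r`-literals, i.e. all its literals count on
the `B`-side. [cite: Pudlak1997, §3] -/
theorem cntB_of_mem_colourCNF {m k c : ℕ} :
    ∀ C ∈ colourCNF m k c, ∀ l ∈ C, cntB l = true := by
  intro C hC l hl
  rcases literal_colourCNF hC hl with ⟨e, b, rfl⟩ | ⟨v, a, b, rfl⟩
  · rfl
  · rfl

/-- **Monotone interpolants of clique–colouring refutations** (Krajíček 1997, §7; Pudlák 1997,
§3): for `2 ≤ k ≤ m`, a resolution refutation `π` of `Clique_{m,k} ∧ Colour_{m,k-1}` yields a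
monotone circuit over `{∧₂, ∨₂}` with at most `2 |π|` gates that accepts the clique vector of
every `k`-set and rejects the colouring vector of every `(k-1)`-colouring.
[cite: Krajicek1997, §7] [cite: Pudlak1997, Thm. 1] -/
theorem exists_monotone_circuit_of_cliqueColour_refutation {m k : ℕ} (hk : 2 ≤ k) (hkm : k ≤ m)
    {π : List (ResLine (CliqueColouring.Var m k (k - 1)))}
    (hπ : IsResRefutation (cliqueColourCNF m k (k - 1)) π) :
    ∃ f : ((⊤ : SimpleGraph (Fin m)).edgeSet → Bool) → Bool,
      (∀ Z : Finset (Fin m), #Z = k → f (cliqueVec Z) = true) ∧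
      (∀ O : Fin m → Fin (k - 1), f (colorVec O) = false) ∧
      ∃ C : Circuit (⊤ : SimpleGraph (Fin m)).edgeSet,
        C.IsOver monotoneBasis ∧ C.size ≤ 2 * π.length ∧ C.Computes f := by
  classical
  -- witnesses for non-constancy: some `k`-set and some `(k-1)`-colouring
  obtain ⟨Z₀, -, hZ₀⟩ := Finset.exists_subset_card_eq (s := (Finset.univ : Finset (Fin m)))
    (n := k) (by simpa using hkm)
  let O₀ : Fin m → Fin (k - 1) := fun _ => ⟨0, by omega⟩
  have hA₀ : SatOver (cliqueCNF m k (k - 1)) (cliqueVec Z₀) := cliqueCNF_satOver_cliqueVec Z₀ hZ₀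
  have hB₁ : SatOver (colourCNF m k (k - 1)) (colorVec O₀) := colourCNF_satOver_colorVec O₀
  obtain ⟨I, -, hIA, hIB, C, hC, hs, hCI⟩ :=
    resolution_monotone_interpolation' (cliqueCNF m k (k - 1)) (colourCNF m k (k - 1))
      cntA_of_mem_cliqueCNF cntB_of_mem_colourCNF hA₀ hB₁ hπ
  exact ⟨I, fun Z hZ => hIA _ (cliqueCNF_satOver_cliqueVec Z hZ),
    fun O => hIB _ (colourCNF_satOver_colorVec O), C, hC, hs, hCI⟩

/-- **Exponential resolution lower bound for the clique–colouring formulas** (Krajíček 1997,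
§7; Pudlák 1997): for all large `m`, with `k = ⌊√m⌋`, every resolution refutation `π` of
`Clique_{m,k}(x,q) ∧ Colour_{m,k-1}(x,r)` satisfies `2^{m^{1/8}} ≤ 2 |π|`. Monotone feasible
interpolation (`resolution_monotone_interpolation'`) plus the Razborov–Alon–Boppana monotone
circuit lower bound (`cliqueSqrt_monotone_lowerBound`, proved in the tree).
[cite: Krajicek1997, §7] [cite: Pudlak1997, Thm. 1] -/
theorem cliqueColour_resolution_lowerBound :
    ∀ᶠ m : ℕ in atTop,
      ∀ π : List (ResLine (CliqueColouring.Var m (Nat.sqrt m) (Nat.sqrt m - 1))),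
        IsResRefutation (cliqueColourCNF m (Nat.sqrt m) (Nat.sqrt m - 1)) π →
          (2 : ℝ) ^ ((m : ℝ) ^ (1 / 8 : ℝ)) ≤ 2 * (π.length : ℝ) := by
  filter_upwards [cliqueSqrt_monotone_lowerBound, eventually_ge_atTop 4] with m hm hm4 π hπ
  have hk : 2 ≤ Nat.sqrt m := by
    rw [Nat.le_sqrt]
    omega
  obtain ⟨f, hpos, hneg, C, hC, hs, hCf⟩ :=
    exists_monotone_circuit_of_cliqueColour_refutation hk (Nat.sqrt_le_self m) hπ
  calc (2 : ℝ) ^ ((m : ℝ) ^ (1 / 8 : ℝ)) ≤ C.size := hm f hpos hneg C hC hCf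
    _ ≤ 2 * (π.length : ℝ) := by exact_mod_cast hs

/-- The clause count of `Clique_{m,⌊√m⌋} ∧ Colour_{m,⌊√m⌋-1}` is at most `5 m³`. [folklore] -/
theorem length_cliqueColourCNF_sqrt_le (m : ℕ) :
    (cliqueColourCNF m (Nat.sqrt m) (Nat.sqrt m - 1)).length ≤ 5 * m ^ 3 := by
  have h := @length_cliqueColourCNF_le m (Nat.sqrt m) (Nat.sqrt m - 1)
  have h1 : Nat.sqrt m ^ 2 ≤ m := by rw [sq]; exact Nat.sqrt_le m
  have h2 : Nat.sqrt m ≤ m := Nat.sqrt_le_self m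
  have h3 : Nat.sqrt m - 1 ≤ Nat.sqrt m := Nat.sub_le _ _
  have h4 : Nat.sqrt m ^ 2 * m ≤ m * m := Nat.mul_le_mul_right _ h1
  have h5 : Nat.sqrt m ^ 2 * m ^ 2 ≤ m * m ^ 2 := Nat.mul_le_mul_right _ h1
  have h6 : m ^ 2 * (Nat.sqrt m - 1) ≤ m ^ 2 * m := Nat.mul_le_mul_left _ (h3.trans h2)
  calc (cliqueColourCNF m (Nat.sqrt m) (Nat.sqrt m - 1)).length
      ≤ Nat.sqrt m + Nat.sqrt m ^ 2 * m + Nat.sqrt m ^ 2 * m ^ 2 + m + m ^ 2 * (Nat.sqrt m - 1) := h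
    _ ≤ m + m * m + m * m ^ 2 + m + m ^ 2 * m := by omega
    _ ≤ 5 * m ^ 3 := by
        have h7 : m ≤ m ^ 3 := Nat.le_self_pow (by norm_num) m
        have h8 : m * m ≤ m ^ 3 := by
          rcases Nat.eq_zero_or_pos m with rfl | hm
          · simp
          · calc m * m = m ^ 2 := (sq m).symm
              _ ≤ m ^ 3 := Nat.pow_le_pow_right hm (by norm_num)
        nlinarith [h7, h8]

/-- **Resolution is not polynomially bounded, via interpolation** (Krajíček 1997, §7;
Pudlák 1997): for all large `m` the clique–colouring CNF `Clique_{m,⌊√m⌋} ∧ Colour_{m,⌊√m⌋-1}`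
is unsatisfiable, has at most `5 m³` clauses, and every resolution refutation of it has length
at least `2^{m^{1/8} - 1}`. [cite: Krajicek1997, §7] [cite: Pudlak1997, Thm. 1] -/
theorem cliqueColour_hard_for_resolution :
    ∀ᶠ m : ℕ in atTop,
      ¬ (cliqueColourCNF m (Nat.sqrt m) (Nat.sqrt m - 1)).Satisfiable ∧
      (cliqueColourCNF m (Nat.sqrt m) (Nat.sqrt m - 1)).length ≤ 5 * m ^ 3 ∧
      ∀ π : List (ResLine (CliqueColouring.Var m (Nat.sqrt m) (Nat.sqrt m - 1))),
        IsResRefutation (cliqueColourCNF m (Nat.sqrt m) (Nat.sqrt m - 1)) π →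
          (2 : ℝ) ^ ((m : ℝ) ^ (1 / 8 : ℝ) - 1) ≤ (π.length : ℝ) := by
  filter_upwards [cliqueColour_resolution_lowerBound, eventually_ge_atTop 1] with m hm hm1
  refine ⟨cliqueColourCNF_not_satisfiable (Nat.sub_lt (Nat.sqrt_pos.2 (by omega)) one_pos),
    length_cliqueColourCNF_sqrt_le m, fun π hπ => ?_⟩
  have h := hm π hπ
  rw [Real.rpow_sub two_pos, Real.rpow_one, div_le_iff₀ (two_pos : (0 : ℝ) < 2)]
  linarith

end Literature.Computability.MetaComplexity
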